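import Summits.PneNP.PneNP.Theorems.SymmetryBudgetNoHiddenOrderValueOrDefs
import Summits.PneNP.PneNP.Theorems.SymmetryBudgetNoHiddenOrderValueGadgets
import Summits.PneNP.PneNP.Theorems.SymmetryBudgetNoHiddenOrderBitValuation
import Summits.PneNP.PneNP.Theorems.SymmetryBudgetNoHiddenOrderDecodeWalkInv

/-!
# `NoHiddenOrder` (stmt-PneNP-14781), (R2c) value layer V: semantics of the value module at an individualisation node

Route `PneNP/SymmetryBudget`; definitions in `SymmetryBudgetNoHiddenOrderValueOrDefs.lean`.  For a label `L = (U, X, λ)` decoded to the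
instance `I = (U, col)` (inputs read it, `VOr.Hyp`), abstract decoding / value maps `dec`, `vl` on labels read by the external candidate wires
(`VOr.Ext`), `Fintype.card V = n`: the kept candidates are exactly the contributions to the offer of `CertifiedLabels.val` at an individualisation
node (`sem_kept_iff`: the certification gates decide `dec (L.cand x v) = some (cgChild G I x)` through EQUALITY OF COLOUR VALUES), the lifted
wires carry `CGBits.lift` of the candidate's value (`lw_iff`), and the outputs read the choice: `sem_orOk_iff` (the offer is non-empty) and
`sem_orBit_iff` (bit `b` of `CGBits.pick` of the offer `offer`, which `…Value.lean` identifies with the offer of `val_orNode`).  Sorry-free;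
supports stmt-PneNP-14781.
-/

set_option linter.dupNamespace false -- `Summit.PneNP.PneNP.…` (D-0017 single-conjunct layout)

namespace Summit.PneNP.PneNP.Theorems

open Finset Literature.Computability.Complexity Literature.Computability.Complexity.SymProg CGBits BranchSum

namespace VOr

variable {ι Λ : Type*} [DecidableEq ι] [DecidableEq Λ] {P : SymProg ι Λ}
variable {V : Type*} [Fintype V] [DecidableEq V] {N T n : ℕ} {U X : Finset V} {lam : V → ℕ}
variable {adm : CertifiedLabels.Label V → Prop} [DecidablePred adm]
variable {O : VOr P V N T n U X lam adm} {x : ι → Bool}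
variable {G : SimpleGraph V} [DecidableRel G.Adj] {I : CGInst V}

/-- **The inputs read the decoded instance `I`** (block `U`, colours `< n`, order, kernel, the first smallest cell on the block, adjacency),
with the bounds. -/
structure Hyp (O : VOr P V N T n U X lam adm) (x : ι → Bool) (G : SimpleGraph V) (I : CGInst V) : Prop where
  /-- the block is `U` -/
  blk : I.1.1 = U
  /-- membership -/
  mem_iff : ∀ u, wval x (P.sem x) (O.mem u) = true ↔ u ∈ I.1.1
  /-- values -/
  val_iff : ∀ u (c : Fin n), wval x (P.sem x) (O.val u c) = true ↔ I.1.2 u = c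
  /-- order -/
  lt_iff : ∀ u v, wval x (P.sem x) (O.lt u v) = true ↔ I.1.2 u < I.1.2 v
  /-- kernel -/
  eq_iff : ∀ u v, wval x (P.sem x) (O.eq u v) = true ↔ I.1.2 u = I.1.2 v
  /-- first smallest cell, on the block -/
  sel_iff : ∀ a ∈ I.1.1, wval x (P.sem x) (O.sel a) = true ↔ 2 ≤ I.1.1.card ∧ a ∈ BranchSum.smallestCell I.1.1 I.1.2
  /-- adjacency -/
  adj_iff : ∀ a b, wval x (P.sem x) (O.adj a b) = true ↔ G.Adj a b
  /-- colours are `< n` everywhere -/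
  col_lt : ∀ v, I.1.2 v < n
  /-- count bound -/
  hN : Fintype.card V ≤ N
  /-- round bound -/
  hT : Fintype.card V ≤ T
  /-- the width is the number of vertices -/
  hn : Fintype.card V = n

/-- **The external candidate wires read the decoding `dec` and the value `vl` of the candidate labels** (for the candidates the module may
keep: `x ∈ U ∖ X`, admissible). -/
structure Ext (O : VOr P V N T n U X lam adm) (x : ι → Bool) (dec : CertifiedLabels.Label V → Option (CGInst V))
    (vl : CertifiedLabels.Label V → Option (BVal n)) : Prop where
  /-- `cdOK κ`: the candidate label decodes -/
  ok_iff : ∀ (y : V) (v : Fin n), y ∈ U → y ∉ X → adm ((lab O).cand y v) →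
    (wval x (P.sem x) (O.cdOK (y, v)) = true ↔ dec ((lab O).cand y v) ≠ none)
  /-- its decoded instance has block `U` and colours `< n`, read by `cdVal` -/
  val_iff : ∀ (y : V) (v : Fin n), y ∈ U → y ∉ X → adm ((lab O).cand y v) → ∀ J, dec ((lab O).cand y v) = some J →
    J.1.1 = U ∧ (∀ w, J.1.2 w < n) ∧ ∀ w (c : Fin n), wval x (P.sem x) (O.cdVal (y, v) w c) = true ↔ J.1.2 w = c
  /-- `cdOk κ`: the candidate label has a value -/
  vok_iff : ∀ (y : V) (v : Fin n), y ∈ U → y ∉ X → adm ((lab O).cand y v) →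
    (wval x (P.sem x) (O.cdOk (y, v)) = true ↔ vl ((lab O).cand y v) ≠ none)
  /-- `cdBit κ b`: the bits of its value -/
  bit_iff : ∀ (y : V) (v : Fin n), y ∈ U → y ∉ X → adm ((lab O).cand y v) → ∀ E, vl ((lab O).cand y v) = some E →
    ∀ b, wval x (P.sem x) (O.cdBit (y, v) b) = true ↔ E b = true

variable {dec : CertifiedLabels.Label V → Option (CGInst V)} {vl : CertifiedLabels.Label V → Option (BVal n)}
variable (h : O.Hyp x G I) (he : O.Ext x dec vl)
include h

/-! ### The individualised colouring at a static vertex and its refinement -/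

omit [DecidableRel G.Adj] h in
/-- The constant false. [folklore] -/
theorem sem_ff : P.sem x O.ff = false := by
  rw [← Bool.not_eq_true, P.sem_or O.kind_ff, O.srcs_ff]; simp

omit [DecidableRel G.Adj] in
/-- `ltx y` reads the order of `indiv col y`. [folklore] -/
theorem sem_ltx_iff (y u v : V) : P.sem x (O.ltx y u v) = true ↔ BranchSum.indiv I.1.2 y u < BranchSum.indiv I.1.2 y v := by
  rw [BranchSum.indiv_lt_iff, P.sem_or (O.kind_ltx y u v), O.srcs_ltx]
  split_ifs with hc
  · simp only [mem_insert, mem_singleton, exists_eq_or_imp, exists_eq_left, h.lt_iff, h.eq_iff]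
    constructor
    · rintro (hl | he')
      · exact Or.inl hl
      · exact Or.inr ⟨he', hc.2, hc.1⟩
    · rintro (hl | ⟨he', -, -⟩)
      · exact Or.inl hl
      · exact Or.inr he'
  · simp only [mem_singleton, exists_eq_left, h.lt_iff]
    constructor
    · exact Or.inl
    · rintro (hl | ⟨-, hu, hv⟩)
      · exact hl
      · exact absurd ⟨hv, hu⟩ hc

omit [DecidableRel G.Adj] in
/-- `eqx y` reads the kernel of `indiv col y`. [folklore] -/
theorem sem_eqx_iff (y u v : V) : P.sem x (O.eqx y u v) = true ↔ BranchSum.indiv I.1.2 y u = BranchSum.indiv I.1.2 y v := by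
  rw [BranchSum.indiv_eq_iff, P.sem_and (O.kind_eqx y u v), O.srcs_eqx]
  split_ifs with hc
  · simp only [mem_singleton, forall_eq, h.eq_iff]; exact ⟨fun he' => ⟨he', hc⟩, fun he' => he'.1⟩
  · simp only [mem_singleton, forall_eq, wval_inr, sem_ff (O := O)]; exact ⟨fun hf => Bool.noConfusion hf, fun he' => absurd he'.2 hc⟩

omit [DecidableRel G.Adj] in
/-- The refinement module at `y` reads the block and `indiv col y`. [folklore] -/
theorem reads_RVc (y : V) : (O.RVc y).Reads x G I.1.1 (BranchSum.indiv I.1.2 y) where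
  mem_iff u := by rw [O.RVc_mem]; exact h.mem_iff u
  adj_iff a b := by rw [O.RVc_adj]; exact h.adj_iff a b
  lt0_iff a _ b _ := by rw [O.RVc_lt0, wval_inr]; exact sem_ltx_iff h y a b
  eq0_iff a _ b _ := by rw [O.RVc_eq0, wval_inr]; exact sem_eqx_iff h y a b

/-- **The value wires at `y` read the child colouring `refineIn G U (indiv col y)`.** [folklore] -/
theorem sem_RVc_iff (y w : V) (c : Fin n) :
    P.sem x ((O.RVc y).val w c) = true ↔ BranchSum.refineIn G I.1.1 (BranchSum.indiv I.1.2 y) w = c :=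
  RefVal.sem_val_iff (reads_RVc h y) ((card_le_univ _).trans h.hN) ((card_le_univ _).trans (h.hT.trans (Nat.le_succ T))) w c

/-! ### Certification and the kept candidates -/

include he

/-- **`eqc (y, v)`**: the candidate decodes to the child of `I` at `y`. [folklore] -/
theorem sem_eqc_iff {y : V} {v : Fin n} (hyU : y ∈ U) (hyX : y ∉ X) (hadm : adm ((lab O).cand y v)) :
    P.sem x (O.eqc (y, v)) = true ↔ dec ((lab O).cand y v) = some (cgChild G I y) := by
  rw [P.sem_and (O.kind_eqc (y, v)), O.srcs_eqc]
  have key : (∀ w ∈ insert (O.cdOK (y, v)) ((univ : Finset (V × Fin n)).image fun wc => Sum.inr (O.xnc (y, v) wc.1 wc.2)),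
      wval x (P.sem x) w = true) ↔
      wval x (P.sem x) (O.cdOK (y, v)) = true ∧ ∀ w c, P.sem x (O.xnc (y, v) w c) = true := by
    simp only [mem_insert, mem_image, mem_univ, true_and, forall_eq_or_imp, Prod.exists]
    constructor
    · rintro ⟨h1, h2⟩
      exact ⟨h1, fun w c => by have := h2 _ ⟨w, c, rfl⟩; rwa [wval_inr] at this⟩
    · rintro ⟨h1, h2⟩
      refine ⟨h1, ?_⟩
      rintro _ ⟨w, c, rfl⟩
      rw [wval_inr]; exact h2 w c
  rw [key, he.ok_iff y v hyU hyX hadm]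
  have hx : ∀ w c, P.sem x (O.xnc (y, v) w c) = true ↔
      (wval x (P.sem x) (O.cdVal (y, v) w c) = true ↔ P.sem x ((O.RVc y).val w c) = true) := by
    intro w c
    rw [P.sem_or (O.kind_xnc _ w c), O.srcs_xnc]
    simp only [mem_insert, mem_singleton, exists_eq_or_imp, exists_eq_left, wval_inr]
    rw [P.sem_and (O.kind_bothc _ w c), O.srcs_bothc, P.sem_nor (O.kind_nonec _ w c), O.srcs_nonec]
    simp only [mem_insert, mem_singleton, forall_eq_or_imp, forall_eq, wval_inr]
    cases wval x (P.sem x) (O.cdVal (y, v) w c) <;> cases P.sem x ((O.RVc y).val w c) <;> simp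
  simp only [hx, sem_RVc_iff h]
  constructor
  · rintro ⟨hne, H⟩
    obtain ⟨J, hJ⟩ := Option.ne_none_iff_exists'.1 hne
    obtain ⟨hblk, hlt, hval⟩ := he.val_iff y v hyU hyX hadm J hJ
    rw [hJ]
    congr 1
    apply Subtype.ext
    apply Prod.ext
    · exact hblk.trans h.blk.symm
    · funext w
      have h1 := (H w ⟨J.1.2 w, hlt w⟩)
      rw [hval] at h1
      exact (h1.1 rfl).symm
  · intro hJ
    obtain ⟨hblk, hlt, hval⟩ := he.val_iff y v hyU hyX hadm _ hJ
    refine ⟨by rw [hJ]; exact Option.some_ne_none _, fun w c => ?_⟩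
    rw [hval w c]
    rfl

/-- **`kept (y, v)`** is exactly the guard of the offer of `val` at an individualisation node. [folklore] -/
theorem sem_kept_iff (κ : V × Fin n) : P.sem x (O.kept κ) = true ↔
    κ.1 ∈ BranchSum.smallestCell I.1.1 I.1.2 ∧ κ.1 ∉ X ∧ 2 ≤ I.1.1.card ∧ adm ((lab O).cand κ.1 κ.2) ∧
      dec ((lab O).cand κ.1 κ.2) = some (cgChild G I κ.1) ∧ vl ((lab O).cand κ.1 κ.2) ≠ none := by
  obtain ⟨y, v⟩ := κ
  by_cases hc : y ∈ U ∧ y ∉ X ∧ adm ((lab O).cand y v)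
  · have hk : P.kind (O.kept (y, v)) = Kind.and := by rw [O.kind_kept, if_pos hc]
    rw [P.sem_and hk, O.srcs_kept, if_pos hc]
    simp only [mem_insert, mem_singleton, forall_eq_or_imp, forall_eq, wval_inr, h.sel_iff y (h.blk.symm ▸ hc.1),
      sem_eqc_iff h he hc.1 hc.2.1 hc.2.2, he.vok_iff y v hc.1 hc.2.1 hc.2.2]
    tauto
  · have hk : P.kind (O.kept (y, v)) = Kind.or := by rw [O.kind_kept, if_neg hc]
    rw [P.sem_or hk, O.srcs_kept, if_neg hc]
    simp only [notMem_empty, false_and, exists_false, false_iff, not_and]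
    intro hy hyX _ hadm
    exact absurd ⟨h.blk ▸ BranchSum.smallestCell_subset _ _ hy, hyX, hadm⟩ hc

/-! ### The lifted value -/

/-- The LIFTED VALUE of a kept candidate: `lift` of the candidate's value. [folklore] -/
noncomputable def LV (O : VOr P V N T n U X lam adm) (G : SimpleGraph V) [DecidableRel G.Adj] (I : CGInst V)
    (vl : CertifiedLabels.Label V → Option (BVal n)) (κ : V × Fin n) : BVal n :=
  lift G n I κ.1 ((vl ((lab O).cand κ.1 κ.2)).getD fun _ => false)

omit he in
/-- `cm y c' c`: the child class `c'` at `y` lies inside the `col`-class `c`. [folklore] -/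
theorem sem_cm_iff (y : V) (c' c : Fin n) : P.sem x (O.cm y c' c) = true ↔
    ∃ u ∈ I.1.1, BranchSum.refineIn G I.1.1 (BranchSum.indiv I.1.2 y) u = c' ∧ I.1.2 u = c := by
  rw [P.sem_or (O.kind_cm y c' c), O.srcs_cm]
  simp only [mem_image, mem_univ, true_and, exists_exists_eq_and, wval_inr]
  refine exists_congr fun u => ?_
  rw [P.sem_and (O.kind_cmu y c' c u), O.srcs_cmu]
  simp only [mem_insert, mem_singleton, forall_eq_or_imp, forall_eq, h.mem_iff, wval_inr, sem_RVc_iff h, h.val_iff]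

/-- **The lifted wires of a kept candidate carry `lift` of its value.** [folklore] -/
theorem lw_iff {κ : V × Fin n} (hk : P.sem x (O.kept κ) = true) (hwf : Wf n I) (b : Fin (NB n)) :
    wval x (P.sem x) (O.lw κ b) = true ↔ LV O G I vl κ b = true := by
  obtain ⟨-, hyX, -, hadm, -, hvl⟩ := (sem_kept_iff h he κ).1 hk
  have hyU : κ.1 ∈ U := by
    have := (sem_kept_iff h he κ).1 hk
    exact h.blk ▸ BranchSum.smallestCell_subset _ _ this.1
  obtain ⟨E, hE⟩ := Option.ne_none_iff_exists'.1 hvl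
  have hLV : LV O G I vl κ = lift G n I κ.1 E := by unfold LV; rw [hE]; rfl
  rw [hLV]
  unfold lift
  rw [if_pos hwf]
  rcases bit_cases b with ⟨i, c, rfl⟩ | ⟨i, j, rfl⟩
  · show wval x (P.sem x) (liftWire O.liftC O.cdBit κ (cIdx i c)) = true ↔ _
    unfold liftWire
    simp only [bdec_cIdx, wval_inr, decide_eq_true_eq]
    rw [P.sem_or (O.kind_liftC κ i c), O.srcs_liftC]
    simp only [mem_image, mem_univ, true_and, exists_exists_eq_and, wval_inr]
    refine exists_congr fun c' => ?_
    rw [P.sem_and (O.kind_lc κ i c' c), O.srcs_lc]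
    simp only [mem_insert, mem_singleton, forall_eq_or_imp, forall_eq, wval_inr, he.bit_iff κ.1 κ.2 hyU hyX hadm E hE]
    exact and_congr_right fun _ => sem_cm_iff h κ.1 c' c
  · show wval x (P.sem x) (liftWire O.liftC O.cdBit κ (aIdx i j)) = true ↔ _
    unfold liftWire
    simp only [bdec_aIdx]
    exact he.bit_iff κ.1 κ.2 hyU hyX hadm E hE _

omit [DecidableRel G.Adj] h he in
/-- The comparison vectors of the gadget are the lifted wires. [folklore] -/
theorem VC_B_eq (κ : V × Fin n) : O.VC.B x κ = fun b => wval x (P.sem x) (O.lw κ b) := by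
  funext b; unfold VecCmp.B; rw [O.VC_b]

/-- For a kept candidate the comparison vector IS the lifted value. [folklore] -/
theorem VC_B_eq_LV {κ : V × Fin n} (hk : P.sem x (O.kept κ) = true) (hwf : Wf n I) : O.VC.B x κ = LV O G I vl κ := by
  rw [VC_B_eq]
  funext b
  rw [Bool.eq_iff_iff, lw_iff h he hk hwf]

/-! ### The choice -/

variable (O G I dec vl) in
/-- **The OFFER**: the lifted values of the kept candidates — stated exactly as the offer of `CertifiedLabels.val` at an individualisation node
with cell `smallestCell`, children `cgChild`, value range `Fintype.card V`; the `Decidable` instance of the guard is an implicit ARGUMENT, so that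
the offer unifies with the one of `val` (which decides its guard classically). [folklore] -/
noncomputable def offer
    {inst : ∀ (y : {y // y ∈ (BranchSum.smallestCell I.1.1 I.1.2).filter fun y => y ∉ X}) (v : ℕ),
      Decidable (adm ((lab O).cand y.1 v) ∧ dec ((lab O).cand y.1 v) = some (cgChild G I y.1))} :
    Finset (BVal n) :=
  ((BranchSum.smallestCell I.1.1 I.1.2).filter fun y => y ∉ X).attach.biUnion fun y =>
    (range (Fintype.card V)).biUnion fun v =>
      @ite _ (adm ((lab O).cand y.1 v) ∧ dec ((lab O).cand y.1 v) = some (cgChild G I y.1)) (inst y v)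
        ((vl ((lab O).cand y.1 v)).map (lift G n I y.1)).toFinset ∅

variable {inst : ∀ (y : {y // y ∈ (BranchSum.smallestCell I.1.1 I.1.2).filter fun y => y ∉ X}) (v : ℕ),
  Decidable (adm ((lab O).cand y.1 v) ∧ dec ((lab O).cand y.1 v) = some (cgChild G I y.1))}

/-- Membership in the offer: the lifted value of a kept candidate. [folklore] -/
theorem mem_offer_iff (h2 : 2 ≤ I.1.1.card) (E : BVal n) :
    E ∈ offer O G I dec vl (inst := inst) ↔ ∃ κ, P.sem x (O.kept κ) = true ∧ E = LV O G I vl κ := by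
  unfold offer
  simp only [mem_biUnion, mem_attach, true_and, Subtype.exists, mem_filter, mem_range]
  constructor
  · rintro ⟨y, ⟨hy, hyX⟩, v, hv, hE⟩
    split_ifs at hE with hc
    · rw [Option.mem_toFinset, Option.mem_def, Option.map_eq_some_iff] at hE
      obtain ⟨E', hE', rfl⟩ := hE
      refine ⟨(y, ⟨v, h.hn ▸ hv⟩), (sem_kept_iff h he _).2 ⟨hy, hyX, h2, hc.1, hc.2, by rw [hE']; simp⟩, ?_⟩
      unfold LV; rw [hE']; rfl
    · simp at hE
  · rintro ⟨⟨y, v⟩, hk, rfl⟩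
    obtain ⟨hy, hyX, -, hadm, hdec, hvl⟩ := (sem_kept_iff h he _).1 hk
    obtain ⟨E', hE'⟩ := Option.ne_none_iff_exists'.1 hvl
    refine ⟨y, ⟨hy, hyX⟩, v, h.hn ▸ v.2, ?_⟩
    rw [if_pos ⟨hadm, hdec⟩, Option.mem_toFinset, Option.mem_def, Option.map_eq_some_iff]
    exact ⟨E', hE', by unfold LV; rw [hE']; rfl⟩

/-- `best κ`: kept, and no kept candidate has a smaller lifted value. [folklore] -/
theorem sem_best_iff (hwf : Wf n I) (κ : V × Fin n) : P.sem x (O.best κ) = true ↔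
    P.sem x (O.kept κ) = true ∧ ∀ κ', P.sem x (O.kept κ') = true → ¬ toLex (LV O G I vl κ') < toLex (LV O G I vl κ) := by
  rw [P.sem_and (O.kind_best κ), O.srcs_best]
  simp only [mem_insert, mem_image, mem_univ, true_and, forall_eq_or_imp, forall_exists_index, forall_apply_eq_imp_iff, wval_inr]
  refine and_congr_right fun hk => forall_congr' fun κ' => ?_
  rw [P.sem_nor_singleton (O.kind_nbeat κ' κ) (O.srcs_nbeat κ' κ), wval_inr, Bool.not_eq_true', ← Bool.not_eq_true,
    P.sem_and (O.kind_beat κ' κ), O.srcs_beat]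
  simp only [mem_insert, mem_singleton, forall_eq_or_imp, forall_eq, wval_inr, O.VC.sem_less, not_and]
  constructor
  · intro H hk'
    have := H hk'
    rwa [VC_B_eq_LV h he hk' hwf, VC_B_eq_LV h he hk hwf] at this
  · intro H hk'
    rw [VC_B_eq_LV h he hk' hwf, VC_B_eq_LV h he hk hwf]
    exact H hk'

/-- **`orOk`** reads "the offer is non-empty". [folklore] -/
theorem sem_orOk_iff (h2 : 2 ≤ I.1.1.card) : P.sem x O.orOk = true ↔ (offer O G I dec vl (inst := inst)).Nonempty := by
  rw [P.sem_or O.kind_orOk, O.srcs_orOk]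
  simp only [mem_image, mem_univ, true_and, exists_exists_eq_and, wval_inr]
  constructor
  · rintro ⟨κ, hk⟩; exact ⟨_, (mem_offer_iff h he h2 _).2 ⟨κ, hk, rfl⟩⟩
  · rintro ⟨E, hE⟩
    obtain ⟨κ, hk, -⟩ := (mem_offer_iff h he h2 E).1 hE
    exact ⟨κ, hk⟩

/-- A best candidate realises the pick of the offer. [folklore] -/
theorem pick_offer_eq_of_best (hwf : Wf n I) (h2 : 2 ≤ I.1.1.card) {κ : V × Fin n} (hb : P.sem x (O.best κ) = true) :
    pick n (offer O G I dec vl (inst := inst)) = some (LV O G I vl κ) := by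
  obtain ⟨hk, hmin⟩ := (sem_best_iff h he hwf κ).1 hb
  have hmem : LV O G I vl κ ∈ offer O G I dec vl (inst := inst) := (mem_offer_iff h he h2 _).2 ⟨κ, hk, rfl⟩
  have hne : (offer O G I dec vl (inst := inst)).Nonempty := ⟨_, hmem⟩
  obtain ⟨E, hE⟩ := Option.ne_none_iff_exists'.1 (pick_ne_none _ hne)
  rw [hE]
  congr 1
  have hle := pick_le hE hmem
  obtain ⟨κ', hk', rfl⟩ := (mem_offer_iff h he h2 _).1 (pick_mem _ _ hE)
  have hnlt := hmin κ' hk'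
  exact toLex_inj.1 (le_antisymm hle (not_lt.1 hnlt))

/-- **`orBit b`** reads bit `b` of the pick of the offer. [folklore] -/
theorem sem_orBit_iff (hwf : Wf n I) (h2 : 2 ≤ I.1.1.card) (b : Fin (NB n)) :
    P.sem x (O.orBit b) = true ↔ ∃ E, pick n (offer O G I dec vl (inst := inst)) = some E ∧ E b = true := by
  rw [P.sem_or (O.kind_orBit b), O.srcs_orBit]
  simp only [mem_image, mem_univ, true_and, exists_exists_eq_and, wval_inr]
  have hob : ∀ κ, P.sem x (O.ob κ b) = true ↔ P.sem x (O.best κ) = true ∧ wval x (P.sem x) (O.lw κ b) = true := by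
    intro κ
    rw [P.sem_and (O.kind_ob κ b), O.srcs_ob]
    simp only [mem_insert, mem_singleton, forall_eq_or_imp, forall_eq, wval_inr]
  simp only [hob]
  constructor
  · rintro ⟨κ, hb, hbit⟩
    have hk := ((sem_best_iff h he hwf κ).1 hb).1
    exact ⟨_, pick_offer_eq_of_best h he hwf h2 hb, (lw_iff h he hk hwf b).1 hbit⟩
  · rintro ⟨E, hE, hEb⟩
    obtain ⟨κ, hk, rfl⟩ := (mem_offer_iff h he h2 _).1 (pick_mem _ _ hE)
    refine ⟨κ, (sem_best_iff h he hwf κ).2 ⟨hk, fun κ' hk' hlt => ?_⟩, (lw_iff h he hk hwf b).2 hEb⟩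
    have hle := pick_le hE ((mem_offer_iff h he h2 _).2 ⟨κ', hk', rfl⟩)
    exact absurd hlt (not_lt.2 hle)

end VOr

end Summit.PneNP.PneNP.Theorems
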